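import Summits.QuantumFields.YangMills.Theorems.UnitScaleTiltProp7SymAvgRelativeAnalytic
import Summits.QuantumFields.YangMills.Theorems.UnitScaleTiltProp7SymAvgGLBridge
import Summits.QuantumFields.YangMills.Theorems.UnitScaleTiltProp7AnalyticRemainderInputs
import Literature.MathematicalPhysics.QuantumFieldTheory.Balaban1983to89.T3PrintedRegularMinimiser
import HarnessLib

/-!
# Route `UnitScaleTilt`, crux K1 child «MinimiserStabilityRegPr» (stmt-QuantumFields-19200), stub `stub_existenceMinimalOrbit` (EX), route (α), node (AVG-SYM) —
# FILE 2 `inputs_CmapSym`: **THE THREE `Inputs` LETTERS OF CHART-47-T³-sym ((44)^sym, (72)^sym, analyticity) FOR THE SYMMETRIC REMAINDER `CmapSym(U₀)` AT A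
# PRINTED-REGULAR BACKGROUND, FROM (AN) + (BD) BY THE SCHWARZ REDUCTION** — `B11Prop3Model.Inputs (CmapSym F n K h U₀) H (40M₀∕R²) (40M₀∕R²) B₀ (R∕4)` with the
# radius `R = L^{−(K−n)}∕(10⁶L²)` and the oscillation `M₀ = 1200L(3·10⁻⁶L⁻² + 18ε₀)`, hence `C₂ = 40M₀∕R²` k-UNIFORM IN PRINT's VARIABLE `A′` (`A = ηA′`, `L^{K−n}η = 1`)

Cell `ym3-torus`, width seat `ym-ust-20520-w4` (gen 2; OWNER ym3-torus-plan g25 03:08:07Z «★w4-20520 g2 holds FILE 2 (after (AN))», W-SEAT MAP 3 «M13 (AN)+FILE 2 stays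
★w4-20520 g2»).  YM₃ on T³ is a ladder rung (R3), NOT the Clay problem; nothing here is a claim about the stub, the crux, d = 4 or the mass gap.
`--supports stmt-QuantumFields-19200 --as helper`; count-neutral.

THE PRINT.  [Balaban1985Variational] (44) p. 285 *«The Proposition 4 of [4] implies … |C_j(L^jηA)| ≤ C₂(L^jη)²|A|²»*, (47)–(49) p. 285, (72) p. 289; print's chart variable is
`A′` with `U′ = exp(iηA′)`, `η = L^{−k}` (p. 285): the exponent `A = ηA′` of ★w1-19200 g2's `logChartSym` is `η`-SMALL, so a radius `R ∝ L^{−(K−n)}` in `A` is a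
radius `∝ 1` in `A′`, and `C₂ = 40M₀∕R²` in `A` is `40M₀·(RL^{K−n})⁻² = 40M₀·10¹²L⁴` in `A′` — independent of the height.

WHAT THIS FILE PROVES (sorry-free; no definition; composition BY NAME).
* §1 letters: `expUnit_eq_expCfg` (`e^{A(b)} = e^{iη·((iη)⁻¹A(b))}` as units of `M₂(ℂ)`), `perturbedField_eq`, `logChartSym_apply_emlIterU` (★w1's `logChartSym` read
  through the bridge `Prop7SymAvgGL.descendToGL_eq_fieldShift_emlIterU` as `mlog` of the relative iterate of `Prop7SymAvgRelativeBound`).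
* §2 the budget once more at the T³ letters (`budget_T3`: `6400ℓ²Lᵏs₀ ≤ 1` and `120ℓLᵏs₀ ≤ 600L(3r + 18ε₀)` from `RegPr`'s window, `10⁷L³ε₀ ≤ 1`, `10⁶L²r ≤ 1`).
* §3 ★★**`inputs_CmapSym`** — for a member `(F, n, K)`, `n ≤ K`, `U₀` with `RegPr F n K ε₀ U₀`, `10⁷L³ε₀ ≤ 1`, any linear `H` with `‖HX‖ ≤ B₀‖X‖`:
  `B11Prop3Model.Inputs (CmapSym F n K h U₀) H (40M₀∕R²) (40M₀∕R²) B₀ (R∕4)` at `R := L^{−(K−n)}∕(10⁶L²)`, `M₀ := 1200L(3∕(10⁶L²) + 18ε₀)` — from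
  `Prop7AnalyticRemainderInputs.inputs_linRemainder_of_analyticOnNhd_of_bound` (★w2-20520 g2, p599231) at `Q := logChartSym F n K h U₀` with (AN)
  `Prop7SymAvgRelativeBound.analyticAt_relIter_of_plaqSmall` (the `AnalyticAt` currency — Mathlib's «differentiable ⇒ analytic» exists only for ONE complex
  variable, `DifferentiableOn.analyticOnNhd {f : ℂ → E}` — ∘ the linear map `A ↦ (iη)⁻¹A`, then `MatrixLog.analyticAt_mlog`, `analyticAt_pi_iff`) and (BD)
  `norm_relIter_sub_one_le_of_plaqSmall` (`M₀` by `MatrixLog.norm_mlog_le_two_mul`), rewritten by ★w1-19200 g2's `Prop7SymAvgGL.CmapSym_eq_linRemainder` (p600171).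
  With `Prop7SymAvgGL.chart47sym_of_inputs` (p599598) this closes CHART-47-T³-sym modulo the `H` slot ((AVG-SYM-46), ★w3-20520 g2) and print's smallness row.
HONEST SCOPE.  Constants crude (`C₂ = C₃`, Schwarz); nothing of [Balaban1985Averaging] is re-proved; the `H`∕`B₀` letter and the contraction window are the consumer's.

References: T. Bałaban, CMP **102** (1985) 277–309 [Balaban1985Variational] ((44)–(49) p.285, (72) p.289); CMP **98** (1985) 17–51 [Balaban1985Averaging]
(Prop. 4 (134)–(135) p.38); CMP **109** (1987) 249–301 [Balaban1987RG1] ((0.4)–(0.11) p.253).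
-/

noncomputable section

open scoped BigOperators Matrix.Norms.L2Operator
open NormedSpace Metric Set

namespace Summit.QuantumFields.YangMills.Theorems.Prop7SymAvgRelativeBound

open Literature.MathematicalPhysics.QuantumFieldTheory.Balaban1983to89
open Literature.MathematicalPhysics.QuantumFieldTheory.Balaban1983to89.T3ContinuumYM3Torus
open T3RegularMinimiser (regThreshold)
open T3PrintedRegularMinimiser (RegPr)
open T3SectALandauChart (bgUnits)
open T4Continuum
open B7Prop1Explicit (expUnit val_expUnit)
open B10Eq27TorusAxialLog (unitsField toUField)
open MatrixLog (mlog analyticAt_mlog norm_mlog_le_two_mul)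
open Summit.QuantumFields.YangMills.Theorems.Prop8Chart (expCfg coe_expCfg emlIterU)
open Summit.QuantumFields.YangMills.Theorems.Prop7SymAvgGL (descendToGL logChartSym QSym CmapSym descendToGL_eq_fieldShift_emlIterU logChartSym_zero
  CmapSym_eq_linRemainder)
open Summit.QuantumFields.YangMills.Theorems.Prop7AnalyticRemainderInputs (inputs_linRemainder_of_analyticOnNhd_of_bound)

variable (F : T3Family) (n K : ℕ) (h : n ≤ K)

/-! ## §1 Letters: ★w1's perturbed field and log-chart in the `Prop8Chart` letters -/

/-- `e^{X} = e^{iη·((iη)⁻¹X)}` as units of `M₂(ℂ)` (`η ≠ 0`): ★w1-19200 g2's `expUnit` IS `Prop8Chart.expCfg η` of the rescaled exponent. [folklore] -/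
theorem expUnit_eq_expCfg {η : ℝ} (hη : η ≠ 0) (A : PBond (F.P K) 0 → Matrix (Fin 2) (Fin 2) ℂ) (b : PBond (F.P K) 0) :
    expUnit (A b) = expCfg η (fun b => (Complex.I * (η : ℂ))⁻¹ • A b) b := by
  apply Units.ext
  have hI : (Complex.I * (η : ℂ)) ≠ 0 := mul_ne_zero Complex.I_ne_zero (by exact_mod_cast hη)
  rw [val_expUnit, coe_expCfg, smul_smul, mul_inv_cancel₀ hI, one_smul]

/-- ★w1's perturbed background `b ↦ e^{A(b)}·U₀♭(b)` IS `b ↦ e^{iηA″(b)}·U₀♭(b)` with `A″ = (iη)⁻¹A` (`bgUnits = unitsField ∘ toUField`). [folklore] -/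
theorem perturbedField_eq {η : ℝ} (hη : η ≠ 0) (U₀ : GaugeField (F.P K) 0 (Matrix.specialUnitaryGroup (Fin 2) ℂ))
    (A : PBond (F.P K) 0 → Matrix (Fin 2) (Fin 2) ℂ) :
    (fun b => expUnit (A b) * bgUnits F K U₀ b) = fun b => expCfg η (fun b => (Complex.I * (η : ℂ))⁻¹ • A b) b * unitsField (toUField U₀) b := by
  funext b
  rw [expUnit_eq_expCfg F K hη A b]
  rfl

/-- **THE LOG-CHART READ IN THE `Prop8Chart` LETTERS**: `logChartSym U₀ A c = mlog( Ū^{(K−n)}[e^{iηA″}·U₀♭](e_c) · (Ū^{(K−n)}[U₀♭](e_c))⁻¹ )` with `e_c` the re-labelled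
top bond (`bondShift`) — ★w1's bridge `descendToGL = fieldShift ∘ emlIterU (K − n)`. [cite: Balaban1987RG1, (0.4) p.253; Balaban1985Variational, (44) p.285] -/
theorem logChartSym_apply_emlIterU {η : ℝ} (hη : η ≠ 0) (U₀ : GaugeField (F.P K) 0 (Matrix.specialUnitaryGroup (Fin 2) ℂ))
    (A : PBond (F.P K) 0 → Matrix (Fin 2) (Fin 2) ℂ) (c : PBond (F.P n) 0) :
    logChartSym F n K h U₀ A c =
      mlog (((emlIterU (K - n) (fun b => expCfg η (fun b => (Complex.I * (η : ℂ))⁻¹ • A b) b * unitsField (toUField U₀) b)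
          (T3LevelShift.bondShift (F.sitesPerDir_eq (m := F.m) (K := n) (j := 0) (m' := F.m) (K' := K) (j' := K - n) (by omega)) c) :
            (Matrix (Fin 2) (Fin 2) ℂ)ˣ) : Matrix (Fin 2) (Fin 2) ℂ) *
        (((emlIterU (K - n) (unitsField (toUField U₀))
          (T3LevelShift.bondShift (F.sitesPerDir_eq (m := F.m) (K := n) (j := 0) (m' := F.m) (K' := K) (j' := K - n) (by omega)) c))⁻¹ :
            (Matrix (Fin 2) (Fin 2) ℂ)ˣ) : Matrix (Fin 2) (Fin 2) ℂ)) := by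
  unfold logChartSym
  rw [descendToGL_eq_fieldShift_emlIterU, descendToGL_eq_fieldShift_emlIterU, perturbedField_eq F K hη U₀ A]
  rfl

variable {F n K}

/-! ## §2 The budget at the T³ letters -/

/-- **THE BUDGET AND THE BOUND OF (BD) AT THE T³ LETTERS** (arithmetic): with `X = Lᵏ` (`k = K − n`), `η = L^{−k}`, `a₀ = regThreshold = ε₀L^{−2k}`, `t = ηr`,
`s_B = 2·3·(3X − 1)a₀`, `s₀ = 2t(1 + s_B) + s_B`: `10⁷L³ε₀ ≤ 1` and `10⁶L²r ≤ 1` give `t ≤ 1`, the parent's budget `6400(5L)²X·s₀ ≤ 1` and `120(5L)X·s₀ ≤ 600L(3r + 18ε₀) ≤ ¼`.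
[cite: Balaban1985Variational, (6) p.278; Balaban1985Averaging, Prop. 4 (134)-(135) p.38] -/
theorem budget_T3 (F : T3Family) (k : ℕ) {ε₀ r : ℝ} (hε₀ : 0 < ε₀) (hε : 10 ^ 7 * (F.L : ℝ) ^ 3 * ε₀ ≤ 1) (hr0 : 0 ≤ r) (hr : 10 ^ 6 * (F.L : ℝ) ^ 2 * r ≤ 1)
    {a₀ : ℝ} (ha₀0 : 0 ≤ a₀) (hXa : (F.L : ℝ) ^ k * ((F.L : ℝ) ^ k * a₀) = ε₀) :
    ((F.L : ℝ)⁻¹) ^ k * r ≤ 1 ∧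
    6400 * (((3 + 2) * F.L : ℕ) : ℝ) ^ 2 * (F.L : ℝ) ^ k *
      (2 * (((F.L : ℝ)⁻¹) ^ k * r) * (1 + 2 * (((3 : ℕ) : ℝ) * (3 * (F.L : ℝ) ^ k - 1)) * a₀) + 2 * (((3 : ℕ) : ℝ) * (3 * (F.L : ℝ) ^ k - 1)) * a₀) ≤ 1 ∧
    120 * (((3 + 2) * F.L : ℕ) : ℝ) * (F.L : ℝ) ^ k *
      (2 * (((F.L : ℝ)⁻¹) ^ k * r) * (1 + 2 * (((3 : ℕ) : ℝ) * (3 * (F.L : ℝ) ^ k - 1)) * a₀) + 2 * (((3 : ℕ) : ℝ) * (3 * (F.L : ℝ) ^ k - 1)) * a₀) ≤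
      600 * (F.L : ℝ) * (3 * r + 18 * ε₀) ∧
    600 * (F.L : ℝ) * (3 * r + 18 * ε₀) ≤ 1 / 4 := by
  have hL3 : 3 ≤ F.L := by obtain ⟨a, ha⟩ := F.hL.1; have := F.hL.2; omega
  have hL3r : (3 : ℝ) ≤ F.L := by exact_mod_cast hL3
  have hL0 : (0 : ℝ) < F.L := by linarith
  have hL1 : (1 : ℝ) ≤ F.L := by linarith
  set X : ℝ := (F.L : ℝ) ^ k with hX
  have hX1 : 1 ≤ X := one_le_pow₀ hL1
  have hX0 : 0 < X := by positivity
  set η : ℝ := ((F.L : ℝ)⁻¹) ^ k with hη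
  have hη0 : 0 < η := by positivity
  have hXη : X * η = 1 := by rw [hX, hη, inv_pow, mul_inv_cancel₀ (pow_ne_zero _ hL0.ne')]
  have hη1 : η ≤ 1 := by
    have : η = X⁻¹ := by rw [hη, hX, inv_pow]
    rw [this]; exact inv_le_one_of_one_le₀ hX1
  set t : ℝ := η * r with ht
  have ht0 : 0 ≤ t := by positivity
  have hr1 : r ≤ 1 := by
    have hL2 : (1 : ℝ) ≤ (F.L : ℝ) ^ 2 := one_le_pow₀ hL1
    have h1 : (1 : ℝ) ≤ 10 ^ 6 * (F.L : ℝ) ^ 2 := by linarith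
    have h2 : 1 * r ≤ 10 ^ 6 * (F.L : ℝ) ^ 2 * r := mul_le_mul_of_nonneg_right h1 hr0
    linarith
  have ht1 : t ≤ 1 := by rw [ht]; exact mul_le_one₀ hη1 hr0 hr1
  have hXt : X * t = r := by rw [ht, ← mul_assoc, hXη, one_mul]
  set sB : ℝ := 2 * (((3 : ℕ) : ℝ) * (3 * (F.L : ℝ) ^ k - 1)) * a₀ with hsB
  have hsB' : sB = 6 * (3 * X - 1) * a₀ := by rw [hsB, ← hX]; push_cast; ring
  have h3X : (0 : ℝ) ≤ 3 * X - 1 := by linarith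
  have hsB0 : 0 ≤ sB := by rw [hsB']; exact mul_nonneg (mul_nonneg (by norm_num) h3X) ha₀0
  have hXsB : X * sB ≤ 18 * ε₀ := by
    have e1 : X * sB = 18 * (X * (X * a₀)) - 6 * (X * a₀) := by rw [hsB']; ring
    rw [e1, hXa]
    linarith [mul_nonneg hX0.le ha₀0]
  have hε1 : ε₀ ≤ 1 / 10 ^ 7 := by
    have h1 : (1 : ℝ) ≤ (F.L : ℝ) ^ 3 := one_le_pow₀ hL1
    have h2 : 10 ^ 7 * ε₀ * 1 ≤ 10 ^ 7 * ε₀ * (F.L : ℝ) ^ 3 := mul_le_mul_of_nonneg_left h1 (by positivity)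
    have h3 : 10 ^ 7 * ε₀ * (F.L : ℝ) ^ 3 = 10 ^ 7 * (F.L : ℝ) ^ 3 * ε₀ := by ring
    rw [le_div_iff₀ (by norm_num)]; linarith
  have hsB1 : sB ≤ 1 / 2 := by
    have : sB ≤ X * sB := le_mul_of_one_le_left hsB0 hX1
    linarith
  set s₀ : ℝ := 2 * t * (1 + sB) + sB with hs₀
  have hXs₀ : X * s₀ ≤ 3 * r + 18 * ε₀ := by
    have h1 : X * s₀ = 2 * (X * t) * (1 + sB) + X * sB := by rw [hs₀]; ring
    rw [h1, hXt]
    have h2 : 2 * r * sB ≤ 2 * r * (1 / 2) := mul_le_mul_of_nonneg_left hsB1 (by positivity)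
    have h3 : 2 * r * (1 + sB) = 2 * r + 2 * r * sB := by ring
    linarith
  have hXs00 : 0 ≤ X * s₀ := by rw [hs₀]; positivity
  have hℓ : (((3 + 2) * F.L : ℕ) : ℝ) = 5 * (F.L : ℝ) := by push_cast; ring
  have hr' : (F.L : ℝ) ^ 2 * r ≤ 1 / 10 ^ 6 := by rw [le_div_iff₀ (by norm_num)]; linarith
  have hε2 : (F.L : ℝ) ^ 2 * ε₀ ≤ 1 / 10 ^ 7 := by
    have h23 : (F.L : ℝ) ^ 2 * ε₀ ≤ (F.L : ℝ) ^ 3 * ε₀ := mul_le_mul_of_nonneg_right (pow_le_pow_right₀ hL1 (by norm_num)) hε₀.le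
    rw [le_div_iff₀ (by norm_num)]; linarith
  refine ⟨ht1, ?_, ?_, ?_⟩
  · rw [hℓ]
    calc 6400 * (5 * (F.L : ℝ)) ^ 2 * X * s₀ = 160000 * (F.L : ℝ) ^ 2 * (X * s₀) := by ring
      _ ≤ 160000 * (F.L : ℝ) ^ 2 * (3 * r + 18 * ε₀) := mul_le_mul_of_nonneg_left hXs₀ (by positivity)
      _ = 480000 * ((F.L : ℝ) ^ 2 * r) + 2880000 * ((F.L : ℝ) ^ 2 * ε₀) := by ring
      _ ≤ 480000 * (1 / 10 ^ 6) + 2880000 * (1 / 10 ^ 7) :=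
          add_le_add (mul_le_mul_of_nonneg_left hr' (by norm_num)) (mul_le_mul_of_nonneg_left hε2 (by norm_num))
      _ ≤ 1 := by norm_num
  · rw [hℓ]
    calc 120 * (5 * (F.L : ℝ)) * X * s₀ = 600 * (F.L : ℝ) * (X * s₀) := by ring
      _ ≤ 600 * (F.L : ℝ) * (3 * r + 18 * ε₀) := mul_le_mul_of_nonneg_left hXs₀ (by positivity)
  · -- `600L·3r = 1800·(L r) ≤ 1800·(L²r) ≤ 1800/10⁶`, `600L·18ε₀ = 10800·(Lε₀) ≤ 10800·(L²ε₀) ≤ 10800/10⁷`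
    have hLr : (F.L : ℝ) * r ≤ (F.L : ℝ) ^ 2 * r := by
      have : (F.L : ℝ) ≤ (F.L : ℝ) ^ 2 := by nlinarith
      exact mul_le_mul_of_nonneg_right this hr0
    have hLε : (F.L : ℝ) * ε₀ ≤ (F.L : ℝ) ^ 2 * ε₀ := by
      have : (F.L : ℝ) ≤ (F.L : ℝ) ^ 2 := by nlinarith
      exact mul_le_mul_of_nonneg_right this hε₀.le
    calc 600 * (F.L : ℝ) * (3 * r + 18 * ε₀) = 1800 * ((F.L : ℝ) * r) + 10800 * ((F.L : ℝ) * ε₀) := by ring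
      _ ≤ 1800 * (1 / 10 ^ 6) + 10800 * (1 / 10 ^ 7) := by
          refine add_le_add (mul_le_mul_of_nonneg_left (hLr.trans hr') (by norm_num)) (mul_le_mul_of_nonneg_left (hLε.trans hε2) (by norm_num))
      _ ≤ 1 / 4 := by norm_num

/-! ## §3 The `Inputs` of CHART-47-T³-sym -/

/-- ★★ **`inputs_CmapSym` — (44)^sym ∧ (72)^sym ∧ ANALYTICITY FOR THE SYMMETRIC REMAINDER AT A PRINTED-REGULAR BACKGROUND, k-UNIFORM IN PRINT's VARIABLE.**
For a member `(F, n, K)`, `n ≤ K`, a background `U₀` with `RegPr F n K ε₀ U₀` and `10⁷L³ε₀ ≤ 1`, and any linear `H` with `‖HX‖ ≤ B₀‖X‖`: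
`B11Prop3Model.Inputs (CmapSym F n K h U₀) H (40M₀∕R²) (40M₀∕R²) B₀ (R∕4)` with `R = L^{−(K−n)}∕(10⁶L²)`, `M₀ = 1200L(3∕(10⁶L²) + 18ε₀)`.
Proof: `Prop7AnalyticRemainderInputs.inputs_linRemainder_of_analyticOnNhd_of_bound` at `Q := logChartSym F n K h U₀` — (AN) from
`analyticAt_relIter_of_plaqSmall` through `A ↦ (iη)⁻¹A` and `MatrixLog.analyticAt_mlog`, (BD) from `norm_relIter_sub_one_le_of_plaqSmall` and
`MatrixLog.norm_mlog_le_two_mul`, budget §2 — then ★w1's `CmapSym_eq_linRemainder`.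
[cite: Balaban1985Variational, (44) p.285, (72) p.289; Balaban1985Averaging, Prop. 4 (134)-(135) p.38; Balaban1987RG1, (0.4) p.253] -/
theorem inputs_CmapSym {ε₀ : ℝ} (hε₀ : 0 < ε₀) (hε : 10 ^ 7 * (F.L : ℝ) ^ 3 * ε₀ ≤ 1)
    (U₀ : GaugeField (F.P K) 0 (Matrix.specialUnitaryGroup (Fin 2) ℂ)) (hreg : RegPr F n K ε₀ U₀)
    {B₀ : ℝ} {H : (PBond (F.P n) 0 → Matrix (Fin 2) (Fin 2) ℂ) →ₗ[ℂ] (PBond (F.P K) 0 → Matrix (Fin 2) (Fin 2) ℂ)} (hH : ∀ X, ‖H X‖ ≤ B₀ * ‖X‖) :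
    B11Prop3Model.Inputs (CmapSym F n K h U₀) H
      (40 * (1200 * (F.L : ℝ) * (3 * (1 / (10 ^ 6 * (F.L : ℝ) ^ 2)) + 18 * ε₀)) / (((F.L : ℝ)⁻¹) ^ (K - n) / (10 ^ 6 * (F.L : ℝ) ^ 2)) ^ 2)
      (40 * (1200 * (F.L : ℝ) * (3 * (1 / (10 ^ 6 * (F.L : ℝ) ^ 2)) + 18 * ε₀)) / (((F.L : ℝ)⁻¹) ^ (K - n) / (10 ^ 6 * (F.L : ℝ) ^ 2)) ^ 2)
      B₀ ((((F.L : ℝ)⁻¹) ^ (K - n) / (10 ^ 6 * (F.L : ℝ) ^ 2)) / 4) := by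
  -- letters
  have hd : (F.P K).d = 3 := T3Family.P_d F K
  have hLL : ((F.P K).L : ℝ) = F.L := rfl
  have hL3 : 3 ≤ F.L := by obtain ⟨a, ha⟩ := F.hL.1; have := F.hL.2; omega
  have hL3r : (3 : ℝ) ≤ F.L := by exact_mod_cast hL3
  have hL0 : (0 : ℝ) < F.L := by linarith
  have hL1 : (1 : ℝ) ≤ F.L := by linarith
  have hk1 : K - n + 1 ≤ (F.P K).m + (F.P K).K := by
    show K - n + 1 ≤ F.m + K; have := F.hm; omega
  set η : ℝ := ((F.L : ℝ)⁻¹) ^ (K - n) with hη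
  have hη0 : 0 < η := by positivity
  have hηne : η ≠ 0 := hη0.ne'
  set r : ℝ := 1 / (10 ^ 6 * (F.L : ℝ) ^ 2) with hr
  have hr0 : 0 ≤ r := by positivity
  have hrr : 10 ^ 6 * (F.L : ℝ) ^ 2 * r ≤ 1 := by rw [hr, mul_one_div_cancel (by positivity)]
  set R : ℝ := η / (10 ^ 6 * (F.L : ℝ) ^ 2) with hR
  have hR0 : 0 < R := by positivity
  have hRη : R = η * r := by rw [hR, hr]; ring
  -- the plaquette window: `a₀ = regThreshold`, `X²a₀ = ε₀`
  set a₀ : ℝ := regThreshold F n K ε₀ with ha₀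
  have ha₀0 : 0 < a₀ := by rw [ha₀]; unfold regThreshold; positivity
  have hXa : (F.L : ℝ) ^ (K - n) * ((F.L : ℝ) ^ (K - n) * a₀) = ε₀ := by
    have hX2 : (F.L : ℝ) ^ (K - n) * (F.L : ℝ) ^ (K - n) = (F.L : ℝ) ^ (2 * (K - n)) := by rw [← pow_add, two_mul]
    have ha : a₀ = ε₀ * ((F.L : ℝ) ^ (2 * (K - n)))⁻¹ := by rw [ha₀]; unfold regThreshold; rw [inv_pow]
    rw [← mul_assoc, hX2, ha, mul_comm ε₀, ← mul_assoc, mul_inv_cancel₀ (pow_ne_zero _ hL0.ne'), one_mul]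
  have hU : PlaqSmall a₀ U₀ := hreg.1
  obtain ⟨ht1, hbudget, hbound, hquarter⟩ := budget_T3 F (K - n) hε₀ hε hr0 hrr ha₀0.le hXa
  -- the bond re-labelling and the rescaled exponent
  set e : PBond (F.P n) 0 → PBond (F.P K) (K - n) :=
    fun c => T3LevelShift.bondShift (F.sitesPerDir_eq (m := F.m) (K := n) (j := 0) (m' := F.m) (K' := K) (j' := K - n) (by omega)) c with he
  set σ : (PBond (F.P K) 0 → Matrix (Fin 2) (Fin 2) ℂ) →L[ℂ] (PBond (F.P K) 0 → Matrix (Fin 2) (Fin 2) ℂ) :=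
    (Complex.I * (η : ℂ))⁻¹ • ContinuousLinearMap.id ℂ (PBond (F.P K) 0 → Matrix (Fin 2) (Fin 2) ℂ) with hσ
  have hσ_apply : ∀ A : PBond (F.P K) 0 → Matrix (Fin 2) (Fin 2) ℂ, σ A = fun b => (Complex.I * (η : ℂ))⁻¹ • A b := fun A => by
    rw [hσ]; rfl
  -- reads of the rescaled exponent on the ball: `‖η·σ(A)(b)‖ = ‖A b‖ ≤ ‖A‖ < R = ηr`, so `≤ t := ηr`
  have hreadsσ : ∀ A : PBond (F.P K) 0 → Matrix (Fin 2) (Fin 2) ℂ, ‖A‖ < R → ∀ b, ‖(η : ℂ) • σ A b‖ ≤ η * r := by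
    intro A hA b
    have hI : (Complex.I * (η : ℂ)) ≠ 0 := mul_ne_zero Complex.I_ne_zero (by exact_mod_cast hηne)
    rw [hσ_apply]
    dsimp only
    rw [smul_smul, norm_smul]
    have hc : ‖(η : ℂ) * (Complex.I * (η : ℂ))⁻¹‖ = 1 := by
      rw [mul_inv, ← mul_assoc, mul_comm (η : ℂ), mul_assoc, mul_inv_cancel₀ (by exact_mod_cast hηne : (η : ℂ) ≠ 0), mul_one, norm_inv,
        Complex.norm_I, inv_one]
    rw [hc, one_mul, ← hRη]
    exact ((norm_le_pi_norm A b).trans hA.le)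
  -- the relative iterate at the rescaled exponent: near `1` (BD) and analytic (AN)
  have hrel : ∀ A : PBond (F.P K) 0 → Matrix (Fin 2) (Fin 2) ℂ, ‖A‖ < R → ∀ c : PBond (F.P n) 0,
      ‖((emlIterU (K - n) (fun b => expCfg η (σ A) b * unitsField (toUField U₀) b) (e c) : (Matrix (Fin 2) (Fin 2) ℂ)ˣ) : Matrix (Fin 2) (Fin 2) ℂ) *
          (((emlIterU (K - n) (unitsField (toUField U₀)) (e c))⁻¹ : (Matrix (Fin 2) (Fin 2) ℂ)ˣ) : Matrix (Fin 2) (Fin 2) ℂ) - 1‖ ≤ 1 / 4 := by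
    intro A hA c
    have h1 := norm_relIter_sub_one_le_of_plaqSmall hk1 U₀ ha₀0 hU η (σ A) ht1 (hreadsσ A hA) (by rw [hd, hLL]; exact hbudget) (e c)
    rw [hd, hLL] at h1
    exact h1.trans (hbound.trans hquarter)
  have hanal : ∀ A₀ : PBond (F.P K) 0 → Matrix (Fin 2) (Fin 2) ℂ, ‖A₀‖ < R → ∀ c : PBond (F.P n) 0,
      AnalyticAt ℂ (fun A : PBond (F.P K) 0 → Matrix (Fin 2) (Fin 2) ℂ =>
        ((emlIterU (K - n) (fun b => expCfg η (σ A) b * unitsField (toUField U₀) b) (e c) : (Matrix (Fin 2) (Fin 2) ℂ)ˣ) : Matrix (Fin 2) (Fin 2) ℂ) *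
          (((emlIterU (K - n) (unitsField (toUField U₀)) (e c))⁻¹ : (Matrix (Fin 2) (Fin 2) ℂ)ˣ) : Matrix (Fin 2) (Fin 2) ℂ)) A₀ := by
    intro A₀ hA₀ c
    have h1 := analyticAt_relIter_of_plaqSmall hk1 U₀ ha₀0 hU η (σ A₀) ht1 (hreadsσ A₀ hA₀) (by rw [hd, hLL]; exact hbudget) (e c)
    exact AnalyticAt.comp_of_eq h1 (σ.analyticAt A₀) rfl
  -- the log-chart in these letters
  have hQ : ∀ A : PBond (F.P K) 0 → Matrix (Fin 2) (Fin 2) ℂ, logChartSym F n K h U₀ A = fun c =>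
      mlog (((emlIterU (K - n) (fun b => expCfg η (σ A) b * unitsField (toUField U₀) b) (e c) : (Matrix (Fin 2) (Fin 2) ℂ)ˣ) : Matrix (Fin 2) (Fin 2) ℂ) *
        (((emlIterU (K - n) (unitsField (toUField U₀)) (e c))⁻¹ : (Matrix (Fin 2) (Fin 2) ℂ)ˣ) : Matrix (Fin 2) (Fin 2) ℂ)) := by
    intro A
    funext c
    rw [logChartSym_apply_emlIterU F n K h hηne U₀ A c, hσ_apply]
  -- (AN): `logChartSym U₀` is analytic on `ball 0 R`
  have han : AnalyticOnNhd ℂ (logChartSym F n K h U₀) (ball (0 : PBond (F.P K) 0 → Matrix (Fin 2) (Fin 2) ℂ) R) := by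
    intro A₀ hA₀
    have hA₀' : ‖A₀‖ < R := mem_ball_zero_iff.1 hA₀
    have hfun : logChartSym F n K h U₀ = fun A => fun c =>
        mlog (((emlIterU (K - n) (fun b => expCfg η (σ A) b * unitsField (toUField U₀) b) (e c) : (Matrix (Fin 2) (Fin 2) ℂ)ˣ) : Matrix (Fin 2) (Fin 2) ℂ) *
          (((emlIterU (K - n) (unitsField (toUField U₀)) (e c))⁻¹ : (Matrix (Fin 2) (Fin 2) ℂ)ˣ) : Matrix (Fin 2) (Fin 2) ℂ)) := by
      funext A; exact hQ A
    rw [hfun]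
    refine analyticAt_pi_iff.mpr fun c => ?_
    have hnear : ‖((emlIterU (K - n) (fun b => expCfg η (σ A₀) b * unitsField (toUField U₀) b) (e c) : (Matrix (Fin 2) (Fin 2) ℂ)ˣ) :
          Matrix (Fin 2) (Fin 2) ℂ) *
        (((emlIterU (K - n) (unitsField (toUField U₀)) (e c))⁻¹ : (Matrix (Fin 2) (Fin 2) ℂ)ˣ) : Matrix (Fin 2) (Fin 2) ℂ) - 1‖ < 1 :=
      (hrel A₀ hA₀' c).trans_lt (by norm_num)
    have hm : AnalyticAt ℂ (mlog : Matrix (Fin 2) (Fin 2) ℂ → Matrix (Fin 2) (Fin 2) ℂ)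
        (((emlIterU (K - n) (fun b => expCfg η (σ A₀) b * unitsField (toUField U₀) b) (e c) : (Matrix (Fin 2) (Fin 2) ℂ)ˣ) : Matrix (Fin 2) (Fin 2) ℂ) *
          (((emlIterU (K - n) (unitsField (toUField U₀)) (e c))⁻¹ : (Matrix (Fin 2) (Fin 2) ℂ)ˣ) : Matrix (Fin 2) (Fin 2) ℂ)) :=
      analyticAt_mlog hnear
    have hcomp := hm.comp_of_eq (hanal A₀ hA₀' c) rfl
    exact hcomp
  -- (BD): the oscillation bound `‖Q A − Q 0‖ ≤ M₀`
  have hbd : ∀ A ∈ ball (0 : PBond (F.P K) 0 → Matrix (Fin 2) (Fin 2) ℂ) R,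
      ‖logChartSym F n K h U₀ A - logChartSym F n K h U₀ 0‖ ≤ 1200 * (F.L : ℝ) * (3 * (1 / (10 ^ 6 * (F.L : ℝ) ^ 2)) + 18 * ε₀) := by
    intro A hA
    have hA' : ‖A‖ < R := mem_ball_zero_iff.1 hA
    rw [logChartSym_zero, sub_zero, hQ A]
    refine (pi_norm_le_iff_of_nonneg (by positivity)).2 fun c => ?_
    have hh : ‖((emlIterU (K - n) (fun b => expCfg η (σ A) b * unitsField (toUField U₀) b) (e c) : (Matrix (Fin 2) (Fin 2) ℂ)ˣ) : Matrix (Fin 2) (Fin 2) ℂ) *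
          (((emlIterU (K - n) (unitsField (toUField U₀)) (e c))⁻¹ : (Matrix (Fin 2) (Fin 2) ℂ)ˣ) : Matrix (Fin 2) (Fin 2) ℂ) - 1‖ ≤
        600 * (F.L : ℝ) * (3 * r + 18 * ε₀) := by
      have h1 := norm_relIter_sub_one_le_of_plaqSmall hk1 U₀ ha₀0 hU η (σ A) ht1 (hreadsσ A hA') (by rw [hd, hLL]; exact hbudget) (e c)
      rw [hd, hLL] at h1
      exact h1.trans hbound
    have hhalf : ‖((emlIterU (K - n) (fun b => expCfg η (σ A) b * unitsField (toUField U₀) b) (e c) : (Matrix (Fin 2) (Fin 2) ℂ)ˣ) : Matrix (Fin 2) (Fin 2) ℂ) *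
          (((emlIterU (K - n) (unitsField (toUField U₀)) (e c))⁻¹ : (Matrix (Fin 2) (Fin 2) ℂ)ˣ) : Matrix (Fin 2) (Fin 2) ℂ) - 1‖ ≤ 1 / 2 :=
      (hrel A hA' c).trans (by norm_num)
    calc _ ≤ 2 * ‖((emlIterU (K - n) (fun b => expCfg η (σ A) b * unitsField (toUField U₀) b) (e c) : (Matrix (Fin 2) (Fin 2) ℂ)ˣ) : Matrix (Fin 2) (Fin 2) ℂ) *
          (((emlIterU (K - n) (unitsField (toUField U₀)) (e c))⁻¹ : (Matrix (Fin 2) (Fin 2) ℂ)ˣ) : Matrix (Fin 2) (Fin 2) ℂ) - 1‖ := norm_mlog_le_two_mul hhalf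
      _ ≤ 2 * (600 * (F.L : ℝ) * (3 * r + 18 * ε₀)) := by linarith
      _ = 1200 * (F.L : ℝ) * (3 * (1 / (10 ^ 6 * (F.L : ℝ) ^ 2)) + 18 * ε₀) := by rw [hr]; ring
  -- the Schwarz reduction, then ★w1's identification of the linear remainder with `CmapSym`
  haveI : CompleteSpace (PBond (F.P n) 0 → Matrix (Fin 2) (Fin 2) ℂ) := FiniteDimensional.complete ℂ _
  have hmain := inputs_linRemainder_of_analyticOnNhd_of_bound (hop := H) hR0 han hbd hH
  rw [CmapSym_eq_linRemainder]
  exact hmain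

end Summit.QuantumFields.YangMills.Theorems.Prop7SymAvgRelativeBound

end
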